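import Summits.BirchSwinnertonDyer.BirchSwinnertonDyer.Theorems.SignedLowerHalvesSmallImageLowerHalfBothSignsLambdaLowerThreeNsAFEClosure
import Summits.BirchSwinnertonDyer.Rank1Residual.X11b.BDPRouteTamagawaSupport
import Summits.BirchSwinnertonDyer.BirchSwinnertonDyer.Theorems.AdditiveBranchIMCGordTwoRankOneSmallImageDicksonTwist
import Literature.NumberTheory.EllipticCurves.Rank1Residual.X9NoEntry
import Literature.NumberTheory.EllipticCurves.Rank1Residual.Typed.X7
import Literature.NumberTheory.EllipticCurves.OpenImageMazurTwistProofs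
import Literature.NumberTheory.EllipticCurves.SerreOpenImageNormalizerCaseProofs
import Mathlib.LinearAlgebra.Matrix.GeneralLinearGroup.Card
import HarnessLib

/-!
# Route `SignedLowerHalves` (K3), child crux L `SmallImageLowerHalfBothSigns` (item stmt-BirchSwinnertonDyer-23599),
# line `birth_acns`, stub `stub_lambdaLowerThree_ns`: the SMALL IMAGE KILLS (ram) — `p ∣ ord_ℓ(Δ_min)` at every
# multiplicative `ℓ`, `p ∣ c_ℓ` at every SPLIT multiplicative `ℓ`, the Fouquet–Wan and BSTW-twist loci are EMPTY on
# the class, and the `λ = 2` closer needs NO Selmer/Tamagawa input at a pair with a split multiplicative prime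
# (cell `bsd-ssimc`, width seat `bsd-line-slh-p3-w3` gen 5; ROUTE-INDEPENDENT helper `--supports 23599`; no `Theses` import)

HONEST FRAMING: CALIBRATION / SUPPORT ONLY — PER PAIR. Crux L, the stub and BSD are NOT proved; the class is infinite
and nothing class-wide about the main conjecture is claimed. §1–§3 are UNCONDITIONAL kernel theorems about elliptic
curves over `ℚ` whose mod-`p` representation is irreducible but NOT surjective (crux L's whole domain: `E[p]` is
irreducible at an odd good supersingular prime, Serre 1972 Prop. 12). §4 is CONDITIONAL on the DISPLAYED binders of
w3 g4's closer (`h12`, `h41`, `hCK`, `hK13`, `h5`, `h3`, the per-pair algebraic functional equation `hAFE` and the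
per-pair certificate / finiteness inputs) — with its divisibility input «`p ∣ Tam(E)·#Sel_{p^∞}(E/ℚ)`» now DISCHARGED
at every pair possessing a split multiplicative prime. THEOREMS ONLY; no definition, no named fact, no `sorry`.

## What is proved (W/ℚ elliptic, globally minimal; `p` prime; `E[p]` irreducible, `ρ̄_{E,p}` NOT onto)

* §1 `dvd_padicValInt_minimalDiscriminantInt_of_mult` — `p ∣ ord_ℓ(Δ_min)` at EVERY multiplicative `ℓ ≠ p` (¬(ram):
  the image has order prime to `p`, Serre Prop. 15, while a (ram) prime puts a transvection of order `p` in it, Tate /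
  Kodaira–Néron; the tree's `Rank1Residual.not_ram_of_irr_of_not_surj` pointwise);
  `not_fwLocus_of_irr_of_not_surj` — the FOUQUET–WAN LOCUS («a non-split multiplicative `ℓ ≠ p` with `ρ̄` ramified
  at `ℓ`», the `hloc` clause of w3 g0/g3/g4's residue theorems) is EMPTY on the class.
* §2 `dvd_localTamagawaNumber_of_split`, `dvd_tamagawaProduct_of_split` — `p ∣ c_ℓ = ord_ℓ(Δ_min)` at every SPLIT
  multiplicative `ℓ ≠ p`, hence `p ∣ ∏_ℓ c_ℓ(E)`; the X7 spellings `…_of_classX7` (at a good `p` the split prime is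
  automatically `≠ p`, and `E[p]` is irreducible by `ClassX7.irr`).
* §3 `dvd_card_range_galoisRepTorsion_of_surj` (`p ∣ #ρ̄(Γ_ℚ)` when `ρ̄` is onto: `#GL₂(𝔽_p) = (p²−1)(p²−p)`) and
  `not_twistLocus_of_irr_of_not_surj` — the BSTW TWIST LOCUS («`E` is a quadratic twist of a semistable curve
  supersingular at `p`», the `htw` clause) is EMPTY on the class: a semistable curve with `E₀[p]` irreducible has
  surjective `ρ̄` (Serre Prop. 21, tree theorem), `p ∣ #ρ̄_{E₀}(Γ_ℚ)`, and `p ∣ #image` transports along the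
  sign-equivariant twist isomorphism `E₀(ℚ̄) ≃ E(ℚ̄)` (tree, Silverman X.5.4) — contradicting `p ∤ #ρ̄_E(Γ_ℚ)`.
* §4 `kobayashiMainConjecture_of_cert_of_finite_of_afe_of_not_surj_of_split` — w3 g4's `λ = 2` CLOSER AT SMALL IMAGE
  with `hdvd : p ∣ Tam·#Sel` REPLACED by «a split multiplicative prime `ℓ`»: certificate `(μ, λ)(L_p^ε) = (0, 2)`,
  `Sel_{p^∞}(E/ℚ)` finite, AFE at the pair ⟹ `KobayashiMainConjecture W p ε` (mod `h12 h41 hCK hK13 h5 h3`); corollaries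
  for the Eisenstein half at one / both signs and the λ-inequality `lam_kobayashiL_le_lam_charGen_of_cert_of_split`.

READING (numbers, not adjectives): on crux L's domain the two PRE engine loci carried by the by-name residue theorems
(`FouquetWan2021_thm51_via_kobayashi74_OPEN`, `BurungaleSkinnerTianWan2024_thm13_twist_OPEN`) bind NOTHING — both
loci are empty there, at every `p`; and on the rank-`0` `(0, 2)`-certified stratum the only per-pair input left,
«`3 ∣ Tam(E)·#Sel_{3^∞}(E/ℚ)`», is AUTOMATIC whenever `E` has a split multiplicative prime (`c_ℓ = ord_ℓ(Δ_min) ≡ 0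
mod 3` there). What remains on that stratum is the set of pairs all of whose multiplicative primes are non-split.

References: [Serre1972] §2.4 Prop. 15, §1.11 Prop. 12, §5.4 Prop. 21; [SilvermanATAEC1994] Cor. IV.9.2(d), V.6 Prop. 6.1,
Ex. 5.13(b); [SilvermanAEC2009] X.5 Cor. 5.4; [SkinnerUrban2014] Thm. 2 (ram); [Kobayashi2003] Thm. 1.2, 4.1, 6.2–7.3,
Conjecture (p. 2); [KimBD2008MRL] Thm. 3.12; [BDKim2013] Cor. 3.15; [FouquetWan2021] Thm. 5.1 (PRE);
[BurungaleSkinnerTianWan2024] Thm. 1.3 (PRE).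
-/

set_option autoImplicit false
-- D-0017: single-problem summit, the namespace repeats the problem name by design.
set_option linter.dupNamespace false

noncomputable section

open scoped Classical MatrixGroups ModularForm

open CongruenceSubgroup PowerSeries WeierstrassCurve Field Literature.NumberTheory.EllipticCurves
  Literature.NumberTheory.GaloisRepresentations
  Literature.NumberTheory.EllipticCurves.ModularForms
  Literature.NumberTheory.EllipticCurves.Rank1Residual
  Literature.NumberTheory.EllipticCurves.Kobayashi2003 ZpExtension
  Literature.NumberTheory.EllipticCurves.Rank1Residual.Typed
  Summit.BirchSwinnertonDyer.Rank1Residual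
  Summit.BirchSwinnertonDyer.Rank1Residual.X1.MuLambda
  Summit.BirchSwinnertonDyer.Rank1Residual.Supersingular

namespace Summit.BirchSwinnertonDyer.BirchSwinnertonDyer.Theorems.SmallImageLambdaLowerThreeNsTamagawa

open SmallImageLambdaLowerThreeNsAFE SmallImageLambdaLowerThreeNsAFEClosure

/-! ## §1. The small image kills (ram): `p ∣ ord_ℓ(Δ_min)` at every multiplicative `ℓ ≠ p`; the FW locus is empty -/

section NoRam

variable (W : WeierstrassCurve ℚ) [W.IsElliptic] [W.IsGloballyMinimal] (p : ℕ) [Fact p.Prime]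

/-- **`p ∣ ord_ℓ(Δ_min)` at EVERY multiplicative prime `ℓ ≠ p`** when `E[p]` is irreducible and `ρ̄_{E,p}` is not onto
(`ρ̄_{E,p}` is UNRAMIFIED at every multiplicative `ℓ ≠ p`: the Tate parameter is a `p`-th power up to units) — the
Skinner–Urban hypothesis (ram) FAILS; pointwise form of the tree theorem `Rank1Residual.not_ram_of_irr_of_not_surj`
(a (ram) prime supplies a transvection of order `p` in the image — Tate curve / Kodaira–Néron — while a proper
irreducible image with full determinant has order prime to `p`, Serre 1972 Prop. 15).
[cite: Serre1972, §2.4 Prop. 15 and §1.12] [cite: SilvermanATAEC1994, V.6 Prop. 6.1 and Exercise 5.13(b)]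
[cite: SkinnerUrban2014, Thm. 2 (p. 3), second bullet] -/
theorem dvd_padicValInt_minimalDiscriminantInt_of_mult (hirr : Irr W p) (hs : ¬ Surj W p)
    {ℓ : ℕ} [Fact ℓ.Prime] (hℓp : ℓ ≠ p) (hmult : W.HasMultiplicativeReductionAtPrime ℓ) :
    p ∣ padicValInt ℓ W.minimalDiscriminantInt := by
  by_contra hnd
  exact not_ram_of_irr_of_not_surj W p hirr hs ⟨ℓ, inferInstance, hℓp, hmult, hnd⟩

/-- **The FOUQUET–WAN LOCUS is EMPTY on the small-image class.** The `hloc` clause of w3 g0/g3/g4's by-name residue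
theorems («some NON-split multiplicative `ℓ ≠ p` with `p ∤ ord_ℓ(Δ_min)`», the locus of the tree's unrefereed binder
`FouquetWan2021_thm51_via_kobayashi74_OPEN`) never holds when `E[p]` is irreducible and `ρ̄_{E,p}` is not onto.
[claim: FouquetWan2021, status: under-review] [cite: Serre1972, §2.4 Prop. 15 and §1.12] -/
theorem not_fwLocus_of_irr_of_not_surj (hirr : Irr W p) (hs : ¬ Surj W p) :
    ¬ ∃ (ℓ : ℕ) (_ : Fact ℓ.Prime), ℓ ≠ p ∧ W.HasMultiplicativeReductionAtPrime ℓ ∧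
        ¬ W.HasSplitMultiplicativeReductionAtPrime ℓ ∧ ¬ p ∣ padicValInt ℓ W.minimalDiscriminantInt := by
  rintro ⟨ℓ, hℓ, hℓp, hmult, -, hnd⟩
  exact hnd (dvd_padicValInt_minimalDiscriminantInt_of_mult W p hirr hs hℓp hmult)

omit [W.IsElliptic] [W.IsGloballyMinimal] in
/-- At a prime `p` of GOOD reduction, a multiplicative prime `ℓ` is automatically `≠ p` (good and multiplicative
reduction exclude each other, Silverman *AEC* VII.5.1). [cite: SilvermanAEC2009, VII.5 Prop. 5.1] -/
theorem ne_of_mult_of_good {ℓ : ℕ} [Fact ℓ.Prime] (hmult : W.HasMultiplicativeReductionAtPrime ℓ)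
    (hgood : W.HasGoodReductionAtPrime p) : ℓ ≠ p := by
  rintro rfl
  have h : ¬ ((W.baseChange ℚ_[ℓ]).minimal ℤ_[ℓ]).HasMultiplicativeReduction ℤ_[ℓ] :=
    WeierstrassCurve.HasGoodReduction.not_hasMultiplicativeReduction (R := ℤ_[ℓ]) hgood
  exact h hmult

/-- `E[p]` is irreducible at an odd prime of good reduction with `a_p = 0` (Serre 1972 Prop. 12; tree theorem
`hasIrreducibleModPGaloisRep_of_dvd_frobeniusTrace`). [cite: Serre1972, §1.11 Prop. 12] -/
theorem irr_of_good_of_frobeniusTrace_eq_zero (hp : p ≠ 2) (hgood : W.HasGoodReductionAtPrime p)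
    (hap : W.frobeniusTrace p = 0) : Irr W p :=
  hasIrreducibleModPGaloisRep_of_dvd_frobeniusTrace W p hp
    (W.not_dvd_minimalDiscriminantInt_of_hasGoodReductionAtPrime' p hgood) (by rw [hap]; exact dvd_zero _)

end NoRam

/-! ## §2. `p ∣ c_ℓ` at every SPLIT multiplicative prime, hence `p ∣ ∏ c_ℓ(E)` -/

section Tamagawa

variable (W : WeierstrassCurve ℚ) [W.IsElliptic] [W.IsGloballyMinimal] (p : ℕ) [Fact p.Prime]

/-- **`p ∣ c_ℓ(E)` at every SPLIT multiplicative prime `ℓ ≠ p`** when `E[p]` is irreducible and `ρ̄_{E,p}` is not onto: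
`c_ℓ = ord_ℓ(Δ_min)` (Kodaira–Néron, Silverman *ATAEC* Cor. IV.9.2(d); tree `X11b.localTamagawaNumber_eq_padicValInt_of_split`)
and §1. [cite: SilvermanATAEC1994, Cor. IV.9.2(d) (PDF p. 340)] [cite: Serre1972, §2.4 Prop. 15] -/
theorem dvd_localTamagawaNumber_of_split (hirr : Irr W p) (hs : ¬ Surj W p) {ℓ : ℕ} [Fact ℓ.Prime] (hℓp : ℓ ≠ p)
    (hsplit : W.HasSplitMultiplicativeReductionAtPrime ℓ) :
    p ∣ (W.baseChange ℚ_[ℓ]).localTamagawaNumber ℤ_[ℓ] := by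
  obtain ⟨v, hv⟩ : ∃ v : IsDedekindDomain.HeightOneSpectrum ℤ, (Rat.HeightOneSpectrum.primesEquiv v : ℕ) = ℓ :=
    ⟨Rat.HeightOneSpectrum.primesEquiv.symm ⟨ℓ, Fact.out⟩, by rw [Equiv.apply_symm_apply]⟩
  rw [X11b.localTamagawaNumber_eq_padicValInt_of_split W v hv hsplit]
  exact dvd_padicValInt_minimalDiscriminantInt_of_mult W p hirr hs hℓp hsplit.hasMultiplicativeReductionAtPrime

/-- **`p ∣ ∏_ℓ c_ℓ(E)` as soon as `E` has a SPLIT multiplicative prime `ℓ ≠ p`** (`E[p]` irreducible, `ρ̄_{E,p}` not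
onto): the factor `c_ℓ = ord_ℓ(Δ_min)` is divisible by `p` (§1) and divides the Tamagawa product (tree
`X11b.dvd_tamagawaProduct_of_split_of_dvd`). [cite: SilvermanATAEC1994, Cor. IV.9.2(d) (PDF p. 340)] [cite: Serre1972, §2.4 Prop. 15] -/
theorem dvd_tamagawaProduct_of_split (hirr : Irr W p) (hs : ¬ Surj W p) {ℓ : ℕ} [Fact ℓ.Prime] (hℓp : ℓ ≠ p)
    (hsplit : W.HasSplitMultiplicativeReductionAtPrime ℓ) : p ∣ W.tamagawaProduct :=
  X11b.dvd_tamagawaProduct_of_split_of_dvd W hsplit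
    (dvd_padicValInt_minimalDiscriminantInt_of_mult W p hirr hs hℓp hsplit.hasMultiplicativeReductionAtPrime)

/-- **`p ∣ Tam(E)·#Sel_{p^∞}(E/ℚ)`** — the divisibility input `hdvd` of w3 g4's `λ = 2` closer — at an odd good prime
`p` with `a_p = 0` and `ρ̄_{E,p}` not onto, from ONE split multiplicative prime `ℓ` (automatically `≠ p`).
[cite: SilvermanATAEC1994, Cor. IV.9.2(d)] [cite: Serre1972, §1.11 Prop. 12 and §2.4 Prop. 15] -/
theorem dvd_tamagawaProduct_mul_card_selmer_of_split (hp : p ≠ 2) (hgood : W.HasGoodReductionAtPrime p)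
    (hap : W.frobeniusTrace p = 0) (hs : ¬ Surj W p) {ℓ : ℕ} [Fact ℓ.Prime]
    (hsplit : W.HasSplitMultiplicativeReductionAtPrime ℓ) :
    p ∣ W.tamagawaProduct * Nat.card (W.selmerGroupPInfty p) :=
  dvd_mul_of_dvd_left
    (dvd_tamagawaProduct_of_split W p (irr_of_good_of_frobeniusTrace_eq_zero W p hp hgood hap) hs
      (ne_of_mult_of_good W p hsplit.hasMultiplicativeReductionAtPrime hgood) hsplit) _

/-- **X7 spelling**: at a small-image X7 pair (`p ≠ 2`, `ClassX7 W p`, `ρ̄_{E,p}` not onto) every split multiplicative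
prime `ℓ` of `E` has `p ∣ c_ℓ(E)` and `p ∣ ∏ c_ℓ(E)`. [cite: SilvermanATAEC1994, Cor. IV.9.2(d)] [cite: Serre1972, §1.11 Prop. 12 and §2.4 Prop. 15] -/
theorem dvd_tamagawaProduct_of_split_of_classX7 (hp : p ≠ 2) (hX : ClassX7 W p) (hs : ¬ Surj W p)
    {ℓ : ℕ} [Fact ℓ.Prime] (hsplit : W.HasSplitMultiplicativeReductionAtPrime ℓ) :
    p ∣ (W.baseChange ℚ_[ℓ]).localTamagawaNumber ℤ_[ℓ] ∧ p ∣ W.tamagawaProduct :=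
  have hℓp : ℓ ≠ p := ne_of_mult_of_good W p hsplit.hasMultiplicativeReductionAtPrime hX.1.1
  ⟨dvd_localTamagawaNumber_of_split W p (ClassX7.irr W p hp hX) hs hℓp hsplit,
    dvd_tamagawaProduct_of_split W p (ClassX7.irr W p hp hX) hs hℓp hsplit⟩

/-- **X7 spelling of §1**: at a small-image X7 pair every multiplicative prime `ℓ` of `E` has `p ∣ ord_ℓ(Δ_min)`
(`ρ̄_{E,p}` is unramified at `ℓ`), and `¬ Ram W p`. [cite: Serre1972, §1.11 Prop. 12, §1.12 and §2.4 Prop. 15] -/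
theorem dvd_padicValInt_minimalDiscriminantInt_of_classX7 (hp : p ≠ 2) (hX : ClassX7 W p) (hs : ¬ Surj W p) :
    ¬ Ram W p ∧ ∀ (ℓ : ℕ) [Fact ℓ.Prime], W.HasMultiplicativeReductionAtPrime ℓ →
      p ∣ padicValInt ℓ W.minimalDiscriminantInt :=
  ⟨not_ram_of_irr_of_not_surj W p (ClassX7.irr W p hp hX) hs, fun _ _ hmult ↦
    dvd_padicValInt_minimalDiscriminantInt_of_mult W p (ClassX7.irr W p hp hX) hs
      (ne_of_mult_of_good W p hmult hX.1.1) hmult⟩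

end Tamagawa

/-! ## §3. The BSTW twist locus is empty on the small-image class -/

section Twist

variable (W : WeierstrassCurve ℚ) [W.IsElliptic] (p : ℕ) [Fact p.Prime]

/-- **`ρ̄_{E,p}` onto ⟹ `p ∣ #ρ̄_{E,p}(Γ_ℚ)`**: in a frame the image is all of `GL₂(𝔽_p)`, of order
`(p² − 1)(p² − p)` (Mathlib `Matrix.card_GL_field`). [folklore] -/
theorem dvd_card_range_galoisRepTorsion_of_surj (hsurj : W.HasSurjectiveModNGaloisRep p) :
    p ∣ Nat.card (galoisRepTorsion W p).range := by
  have hp : p.Prime := Fact.out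
  obtain ⟨e, Φ, he, -⟩ := exists_frame_galoisRepTorsion_rat W p
  rw [← card_map_range_galoisRepTorsion W p Φ, (map_range_galoisRepTorsion_eq_top_iff W p Φ).mpr hsurj,
    Subgroup.card_top, Matrix.card_GL_field, ZMod.card, Fin.prod_univ_two]
  refine Dvd.dvd.mul_left ?_ _
  simp only [Fin.val_one, pow_one]
  exact Nat.dvd_sub (dvd_pow_self p two_ne_zero) (dvd_refl p)

/-- **`p ∣ #image` transports from a curve to a model of its quadratic twist** (`p` odd): if
`C • W₀.quadraticTwist d = W` (`d ≠ 0`) and `p ∣ #ρ̄_{W₀,p}(Γ_ℚ)`, then `p ∣ #ρ̄_{W,p}(Γ_ℚ)` — the sign-equivariant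
twist isomorphism `W₀^{(d)}(ℚ̄) ≃ W₀(ℚ̄)` (tree `exists_addEquiv_geomPoints_quadraticTwist_signed`) inverted and
composed with the equivariant change of equation, fed to the tree's `dvd_card_range_galoisRepTorsion_of_addEquiv_signed`.
[cite: SilvermanAEC2009, X.5 Cor. 5.4 and X.2 Prop. 2.4] [cite: Serre1972, §2.4 Prop. 15] -/
theorem dvd_card_range_galoisRepTorsion_of_eq_smul_quadraticTwist (hp2 : p ≠ 2) (W₀ : WeierstrassCurve ℚ)
    {d : ℚ} (hd : d ≠ 0) {C : VariableChange ℚ} (hW : C • W₀.quadraticTwist d = W)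
    (hdvd : p ∣ Nat.card (galoisRepTorsion W₀ p).range) :
    p ∣ Nat.card (galoisRepTorsion W p).range := by
  subst hW
  haveI : NeZero (2 : ℚ) := ⟨two_ne_zero⟩
  obtain ⟨f, hf⟩ := W₀.exists_addEquiv_geomPoints_quadraticTwist_signed hd
  -- the inverse of a sign-equivariant isomorphism is sign-equivariant (same sign)
  have hf' : ∀ σ : absoluteGaloisGroup ℚ,
      (∀ Q, f.symm (σ • Q) = σ • f.symm Q) ∨ (∀ Q, f.symm (σ • Q) = -(σ • f.symm Q)) := by
    intro σ
    rcases hf σ with h | h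
    · refine Or.inl fun Q ↦ f.injective ?_
      rw [f.apply_symm_apply, h, f.apply_symm_apply]
    · refine Or.inr fun Q ↦ f.injective ?_
      rw [f.apply_symm_apply, map_neg, h, f.apply_symm_apply, neg_neg]
  -- the equivariant change of equation
  let e : geomPoints (W₀.quadraticTwist d) ≃+ geomPoints (C • W₀.quadraticTwist d) :=
    VariableChange.pointEquivBaseChange (W₀.quadraticTwist d) C (AlgebraicClosure ℚ)
  have he : ∀ (σ : absoluteGaloisGroup ℚ) (P : geomPoints (W₀.quadraticTwist d)), e (σ • P) = σ • e P :=
    fun σ P ↦ VariableChange.pointEquivBaseChange_map_algEquiv (W₀.quadraticTwist d) C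
      (absoluteGaloisGroup.toAlgEquiv ℚ σ) P
  refine AdditiveBranchIMCGordTwoRankOne.SmallImageDickson.dvd_card_range_galoisRepTorsion_of_addEquiv_signed p (C • W₀.quadraticTwist d) W₀ hp2
    (f.symm.trans e) (fun σ ↦ ?_) hdvd
  rcases hf' σ with h | h
  · exact Or.inl fun P ↦ by rw [AddEquiv.trans_apply, AddEquiv.trans_apply, h, he]
  · exact Or.inr fun P ↦ by rw [AddEquiv.trans_apply, AddEquiv.trans_apply, h, map_neg, he]

/-- **The BSTW TWIST LOCUS is EMPTY on the small-image class** (`p` odd, `E[p]` irreducible, `ρ̄_{E,p}` NOT onto): `E`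
is NOT (a model of) a quadratic twist of a semistable curve `E₀` with good supersingular reduction at `p` — the `htw`
clause of w3 g0/g3/g4's by-name residue theorems (locus of the tree's unrefereed binder
`BurungaleSkinnerTianWan2024_thm13_twist_OPEN`) never holds. Indeed `E₀[p]` is irreducible (Serre Prop. 12) and `E₀`
semistable, so `ρ̄_{E₀,p}` is onto (Serre Prop. 21, tree theorem `Rank1Residual.surj_of_irr_of_semistable`),
`p ∣ #ρ̄_{E₀,p}(Γ_ℚ)`, which transports to
`E` — contradicting `p ∤ #ρ̄_{E,p}(Γ_ℚ)` (Serre Prop. 15). The statement keeps the FULL clause shape (field `K`,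
coprimality, ordinary primes of `disc K`) although only semistability, `GoodSS E₀ p` and the twist equation are used.
[claim: BurungaleSkinnerTianWan2024, status: under-review] [cite: Serre1972, §1.11 Prop. 12, §2.4 Prop. 15, §5.4 Prop. 21]
[cite: SilvermanAEC2009, X.5 Cor. 5.4] -/
theorem not_twistLocus_of_irr_of_not_surj (hp2 : p ≠ 2) (hirr : Irr W p) (hs : ¬ Surj W p) :
    ¬ ∃ (W₀ : WeierstrassCurve ℚ) (_ : W₀.IsElliptic) (_ : W₀.IsGloballyMinimal)
        (K : Type) (_ : Field K) (_ : NumberField K),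
        Semistable W₀ ∧ GoodSS W₀ p ∧ (p = 3 → W₀.frobeniusTrace 3 = 0) ∧ Module.finrank ℚ K = 2 ∧
        IsCoprime (NumberField.discr K) ((W₀.conductorNorm ℤ * p : ℕ) : ℤ) ∧
        (∀ (ℓ : ℕ) [Fact ℓ.Prime], (ℓ : ℤ) ∣ NumberField.discr K → GoodOrd W₀ ℓ) ∧
        ∃ C : VariableChange ℚ, C • W₀.quadraticTwist (NumberField.discr K : ℚ) = W := by
  rintro ⟨W₀, _, _, K, _, _, hsst, hss, -, -, -, -, C, hC⟩
  -- `p ∤ #ρ̄_E(Γ_ℚ)` (Serre Prop. 15 in a frame)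
  have hW : ¬ p ∣ Nat.card (galoisRepTorsion W p).range := by
    obtain ⟨e, Φ, he, -⟩ := exists_frame_galoisRepTorsion_rat W p
    rw [← card_map_range_galoisRepTorsion W p Φ]
    exact not_dvd_card_of_not_hasSurjectiveModNGaloisRep W p Φ e he hirr hs
  -- `ρ̄_{E₀,p}` is onto
  have hirr₀ : Irr W₀ p :=
    hasIrreducibleModPGaloisRep_of_dvd_frobeniusTrace W₀ p hp2
      (W₀.not_dvd_minimalDiscriminantInt_of_hasGoodReductionAtPrime' p hss.1) hss.2
  have hsurj₀ : Surj W₀ p := surj_of_irr_of_semistable W₀ p hirr₀ hsst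
  have hd : (NumberField.discr K : ℚ) ≠ 0 := by exact_mod_cast NumberField.discr_ne_zero K
  exact hW (dvd_card_range_galoisRepTorsion_of_eq_smul_quadraticTwist W p hp2 W₀ hd hC
    (dvd_card_range_galoisRepTorsion_of_surj W₀ p hsurj₀))

end Twist

/-! ## §4. The `λ = 2` closer at small image with the Tamagawa input discharged by a split multiplicative prime -/

section Closer

variable (W : WeierstrassCurve ℚ) [W.IsElliptic] [W.IsGloballyMinimal] (p : ℕ) [Fact p.Prime]

/-- **Kobayashi's main conjecture for `(E, p, ε)` at a NON-SURJECTIVE pair WITH A SPLIT MULTIPLICATIVE PRIME, from the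
certificate `(μ, λ)(L_p^ε) = (0, 2)`, `Sel_{p^∞}(E/ℚ)` FINITE, and the algebraic functional equation AT THE PAIR** —
w3 g4's `kobayashiMainConjecture_of_cert_of_finite_of_dvd_of_afe_of_not_surj` with its input «`p ∣ ∏ c_ℓ · #Sel`»
supplied by §2 (`p ∣ c_ℓ` at the split prime). BY NAME `h12`, `h41` (rational display), `hCK`, `hK13`, `h5`, `h3`;
`hAFE` (Kim 2008 Thm. 3.12 at the pair: a named fact for `p > 3`, a HYPOTHESIS at `p = 3`). Odd good `p`, `a_p = 0`.
PER PAIR; CONDITIONAL on the displayed binders. [cite: Kobayashi2003, Thm. 1.2, Thm. 4.1 (p. 8), Thm. 6.2–6.3, Thm. 7.3 (7.21) and Conjecture (p. 2)]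
[cite: KimBD2008MRL, Thm. 3.12 (p. 93)] [cite: BDKim2013, Cor. 3.15 (p. 199)] [cite: SilvermanATAEC1994, Cor. IV.9.2(d)]
[cite: Serre1972, §2.4 Prop. 15] -/
theorem kobayashiMainConjecture_of_cert_of_finite_of_afe_of_not_surj_of_split
    (h12 : thm12_signedSelmerDual_finite_torsion) (h41 : thm41_signedCharIdeal_divisibility)
    (hCK : thm62_63_73_signedColemanKato_zeta) (hK13 : BDKim2013.cor315_signedCharValue_rankZero)
    (h5 : realPeriodRat_eq_unit_mul_plusPeriod) (h3 : realPeriodRat_eq_unit_mul_plusPeriod_three)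
    (hp : p ≠ 2) (hgood : W.HasGoodReductionAtPrime p) (hap : W.frobeniusTrace p = 0) (hs : ¬ Surj W p) (ε : ℤˣ)
    (hAFE : ∀ (κ : ZpExtension ℚ p) (γ : absoluteGaloisGroup ℚ), κ.IsCyclotomic → κ.IsTopGenerator γ →
      ∀ D : SignedSelmerDualData W κ γ ε, Ideal.map (IwasawaAlgebra.invol p) D.charIdeal = D.charIdeal)
    [NeZero (W.conductorNorm ℤ)] {f₀ : CuspForm (Gamma0 (W.conductorNorm ℤ)) 2} (hf₀ : IsNewformOf W f₀)
    (hcert₀ : ∀ L : IwasawaAlgebra p, IsSignedPAdicLFunction f₀ p ε L → mu L = 0 ∧ lam L = 2)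
    (hfin : Finite (W.selmerGroupPInfty p))
    {ℓ : ℕ} [Fact ℓ.Prime] (hsplit : W.HasSplitMultiplicativeReductionAtPrime ℓ) :
    KobayashiMainConjecture W p ε :=
  kobayashiMainConjecture_of_cert_of_finite_of_dvd_of_afe_of_not_surj W p h12 h41 hCK hK13 h5 h3 hp hgood hap hs ε
    hAFE hf₀ hcert₀ hfin (dvd_tamagawaProduct_mul_card_selmer_of_split W p hp hgood hap hs hsplit)

/-- **Corollary — the Eisenstein half `KobayashiLowerDivisibility W p ε` at the pair and sign** (crux L's body at ONE
pair and sign) under the hypotheses of the previous theorem. [cite: Kobayashi2003, Conjecture (p. 2)]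
[cite: KimBD2008MRL, Thm. 3.12 (p. 93)] [cite: SilvermanATAEC1994, Cor. IV.9.2(d)] -/
theorem kobayashiLowerDivisibility_of_cert_of_finite_of_afe_of_not_surj_of_split
    (h12 : thm12_signedSelmerDual_finite_torsion) (h41 : thm41_signedCharIdeal_divisibility)
    (hCK : thm62_63_73_signedColemanKato_zeta) (hK13 : BDKim2013.cor315_signedCharValue_rankZero)
    (h5 : realPeriodRat_eq_unit_mul_plusPeriod) (h3 : realPeriodRat_eq_unit_mul_plusPeriod_three)
    (hp : p ≠ 2) (hgood : W.HasGoodReductionAtPrime p) (hap : W.frobeniusTrace p = 0) (hs : ¬ Surj W p) (ε : ℤˣ)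
    (hAFE : ∀ (κ : ZpExtension ℚ p) (γ : absoluteGaloisGroup ℚ), κ.IsCyclotomic → κ.IsTopGenerator γ →
      ∀ D : SignedSelmerDualData W κ γ ε, Ideal.map (IwasawaAlgebra.invol p) D.charIdeal = D.charIdeal)
    [NeZero (W.conductorNorm ℤ)] {f₀ : CuspForm (Gamma0 (W.conductorNorm ℤ)) 2} (hf₀ : IsNewformOf W f₀)
    (hcert₀ : ∀ L : IwasawaAlgebra p, IsSignedPAdicLFunction f₀ p ε L → mu L = 0 ∧ lam L = 2)
    (hfin : Finite (W.selmerGroupPInfty p))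
    {ℓ : ℕ} [Fact ℓ.Prime] (hsplit : W.HasSplitMultiplicativeReductionAtPrime ℓ) :
    KobayashiLowerDivisibility W p ε :=
  kobayashiLowerDivisibility_of_mainConjecture
    (kobayashiMainConjecture_of_cert_of_finite_of_afe_of_not_surj_of_split W p h12 h41 hCK hK13 h5 h3 hp hgood hap hs ε
      hAFE hf₀ hcert₀ hfin hsplit)

/-- **Corollary — crux L's body `∀ ε, KobayashiLowerDivisibility W p ε` AT ONE PAIR WITH A SPLIT MULTIPLICATIVE PRIME from
the certificate `(0, 2)` at BOTH signs**, `Sel_{p^∞}(E/ℚ)` finite, AFE at both signs — no Tamagawa / Selmer-order input.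
PER PAIR; the crux (ALL small-image X7 pairs) is NOT proved. [cite: Kobayashi2003, Conjecture (p. 2)] [cite: KimBD2008MRL, Thm. 3.12 (p. 93)]
[cite: SilvermanATAEC1994, Cor. IV.9.2(d)] -/
theorem forall_kobayashiLowerDivisibility_of_certs_of_finite_of_afe_of_not_surj_of_split
    (h12 : thm12_signedSelmerDual_finite_torsion) (h41 : thm41_signedCharIdeal_divisibility)
    (hCK : thm62_63_73_signedColemanKato_zeta) (hK13 : BDKim2013.cor315_signedCharValue_rankZero)
    (h5 : realPeriodRat_eq_unit_mul_plusPeriod) (h3 : realPeriodRat_eq_unit_mul_plusPeriod_three)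
    (hp : p ≠ 2) (hgood : W.HasGoodReductionAtPrime p) (hap : W.frobeniusTrace p = 0) (hs : ¬ Surj W p)
    (hAFE : ∀ (ε : ℤˣ) (κ : ZpExtension ℚ p) (γ : absoluteGaloisGroup ℚ), κ.IsCyclotomic → κ.IsTopGenerator γ →
      ∀ D : SignedSelmerDualData W κ γ ε, Ideal.map (IwasawaAlgebra.invol p) D.charIdeal = D.charIdeal)
    [NeZero (W.conductorNorm ℤ)] {f₀ : CuspForm (Gamma0 (W.conductorNorm ℤ)) 2} (hf₀ : IsNewformOf W f₀)
    (hcert : ∀ (ε : ℤˣ) (L : IwasawaAlgebra p), IsSignedPAdicLFunction f₀ p ε L → mu L = 0 ∧ lam L = 2)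
    (hfin : Finite (W.selmerGroupPInfty p))
    {ℓ : ℕ} [Fact ℓ.Prime] (hsplit : W.HasSplitMultiplicativeReductionAtPrime ℓ) :
    ∀ ε : ℤˣ, KobayashiLowerDivisibility W p ε :=
  fun ε ↦ kobayashiLowerDivisibility_of_cert_of_finite_of_afe_of_not_surj_of_split W p h12 h41 hCK hK13 h5 h3 hp hgood
    hap hs ε (hAFE ε) hf₀ (hcert ε) hfin hsplit

end Closer

/-! ## §5. The λ-stub's content at a datum, with the Tamagawa input discharged by a split multiplicative prime -/

section Stub

variable {p : ℕ} [Fact p.Prime] {W : WeierstrassCurve ℚ} [W.IsElliptic] [W.IsGloballyMinimal]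
  {κ : ZpExtension ℚ p} {γ : absoluteGaloisGroup ℚ} {ε : ℤˣ}

/-- **The Eisenstein λ-inequality `λ(L_p^ε) ≤ λ(ξ^ε)` at a datum of a NON-SURJECTIVE pair WITH A SPLIT MULTIPLICATIVE
PRIME, from the certificate `μ(L_p^ε) = 0 ∧ λ(L_p^ε) ≤ 2`** (the shape the by-name reading
`smallImageLambdaLowerAtThree_iff_lamLe'` consumes): w3 g4's `lam_kobayashiL_le_lam_charGen_of_cert_of_not_surj` with
«`p ∣ ∏ c_ℓ · #Sel`» supplied by §2. Granted `h12 hCK hK13 h5 h3`; rank `0` (`Sel_{p^∞}(E/ℚ)` finite); AFE at `D`.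
[cite: Kobayashi2003, Thm. 1.2, Thm. 6.2–6.3, Thm. 7.3 (7.21) and Conjecture (p. 2)] [cite: KimBD2008MRL, Thm. 3.12 (p. 93)]
[cite: BDKim2013, Cor. 3.15 (p. 199)] [cite: SilvermanATAEC1994, Cor. IV.9.2(d)] -/
theorem lam_kobayashiL_le_lam_charGen_of_cert_of_split
    (h12 : thm12_signedSelmerDual_finite_torsion) (hCK : thm62_63_73_signedColemanKato_zeta)
    (hK13 : BDKim2013.cor315_signedCharValue_rankZero)
    (h5 : realPeriodRat_eq_unit_mul_plusPeriod) (h3 : realPeriodRat_eq_unit_mul_plusPeriod_three)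
    (hp : p ≠ 2) (hgood : W.HasGoodReductionAtPrime p) (hap : W.frobeniusTrace p = 0) (hs : ¬ Surj W p)
    [NeZero (W.conductorNorm ℤ)] {f : CuspForm (Gamma0 (W.conductorNorm ℤ)) 2} (hf : IsNewformOf W f)
    (hκ : κ.IsCyclotomic) (hγ : κ.IsTopGenerator γ) (hγ' : IsCyclotomicVariable p γ)
    {Lplus Lminus : IwasawaAlgebra p} (hPP : IsPollackPair f p Lplus Lminus)
    (hμL : mu (kobayashiL ε Lplus Lminus) = 0) (hL2 : lam (kobayashiL ε Lplus Lminus) ≤ 2)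
    (D : SignedSelmerDualData W κ γ ε) {ξ : IwasawaAlgebra p} (hξ : D.charIdeal = Ideal.span {ξ})
    (hAFE : Ideal.map (IwasawaAlgebra.invol p) D.charIdeal = D.charIdeal)
    (hfin : Finite (W.selmerGroupPInfty p))
    {ℓ : ℕ} [Fact ℓ.Prime] (hsplit : W.HasSplitMultiplicativeReductionAtPrime ℓ) :
    lam (kobayashiL ε Lplus Lminus) ≤ lam ξ :=
  lam_kobayashiL_le_lam_charGen_of_cert_of_not_surj h12 hCK hK13 h5 h3 hp hgood hap hs hf hκ hγ hγ' hPP hμL hL2 D hξ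
    hAFE hfin (dvd_tamagawaProduct_mul_card_selmer_of_split W p hp hgood hap hs hsplit)

end Stub

end Summit.BirchSwinnertonDyer.BirchSwinnertonDyer.Theorems.SmallImageLambdaLowerThreeNsTamagawa

end
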